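import Literature.IUT.HodgeArakelov.ThetaSettingThetaKerGeomNielsenMoveAtModelTate
import Literature.AnabelianGeometry.EtaleTheta.SettingModelChiDoubleUnderline
import Literature.AnabelianGeometry.EtaleTheta.SettingModelTateDeltaTheta
import Literature.AnabelianGeometry.EtaleTheta.TemperedCoverings
import Literature.AnabelianGeometry.SemiGraphs.TemperedCompletionRestrict
import Literature.AnabelianGeometry.SemiGraphs.TemperedCompletionExistence
import Literature.AnabelianGeometry.SemiGraphs.ProfiniteCompletionEta
import HarnessLib

/-!
# The (Θ)-clause of [EtTh] Cor. 2.18 (i) is NOT a property of the geometric tempered group `Δ^tp_{X̲̲}` alone: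
# `⋂_N Ker ĥ_N ∩ dUU l` is not characteristic in `dUU l` (proof-only; K-L6 row «HTHETA-GEOM-NEG@modelTate», file 2 of 2)

S. Mochizuki, *The étale theta function and its Frobenioid-theoretic manifestations* [EtTh], Publ. RIMS **45**
(2009), Cor. 2.18 (i) p. 60 [cite: MochizukiEtTh2009, Cor 2.18(i) p.60]; §1 p. 12 (`Π^tp_X`, `Δ^Θ_X`,
"`Δ_X` … a profinite free group on 2 generators") [cite: MochizukiEtTh2009, §1 p.12]; Def. 2.5 (i) p. 39 (`X̲̲`)
[cite: MochizukiEtTh2009, Def 2.5 (i) p.39].  S. Mochizuki, *Semi-graphs of anabelioids* [SemiAnbd], Publ. RIMS **42**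
(2006), §6 p. 69 ("the profinite completion") [cite: MochizukiSemiAnbd2006, §6 p.69].  S. Mochizuki, *Inter-universal
Teichmüller theory II*, §1, Cor. 1.12 (ii)(iii) / Prop. 1.4 (the consumer display carrying the binder `hΘ`)
[claim: Mochizuki2012, status: disputed] (IUTchII §1 Cor 1.12, kurims p.32).  Cell `abc-iut`, K-L6 slice, row
«HTHETA-GEOM-NEG@modelTate» (abc-iut-L6-lead gen 8, §F v1.19em (C) GO 2026-08-27T06:10Z), seat abc-iut-w5-d169 (gen 13).
PROOF-ONLY: no definition, no instance, no new named fact; inputs BY NAME — abc-iut-L2-t1's finer model (`Gfp`, `eHat`,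
`hHat`, `Del`, `etaCont`), abc-iut-L2-d1's `dUU` / `levelHom`, abc-iut-L6-d6's `mem_thetaKerχq_iff`, the L3 interface
`IsProfiniteCompletion.exists_restrict_of_isOpen_of_finiteIndex` / `index_topologicalClosure_map_eq` / `exists_extension`
/ `extension_unique`, `IsTopCharacteristic` (`TemperedCoverings`), and file 1 (`exists_nielsen_cyclicKernel`).

THE BINDER AND THE NEGATIVE.  `hΘ := IsTopCharacteristic C.Huu (toTheta.ker.subgroupOf C.Huu)` at
`C.Huu = Huuχq p 1 2 l = dUU l ⋊_{actχq} G_{ℚ_p}` is the ONE remaining F-0620 residual of the K-L6 display of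
[IUTchII] Cor. 1.12 (ii)(iii) at the Tate model (abc-iut-w6-d028 p498716; abc-iut-L6-lead §F v1.19ee (A):
UNDECIDED-AT-MODEL).  By `mem_thetaKerχq_iff` the `Γ`-part of `Ker(Π^tp_X ↠ (Π^tp_X)^Θ)` is
`K := ⋂_N Ker(ĥ_N ∘ pr₁) = (thetaKer).comap inl`, and `hΘ` restricted to the geometric subgroup says in particular
that every bi-continuous automorphism of `dUU l ⋊ G_{ℚ_p}` carries `K ∩ dUU l` onto itself.  THIS FILE proves that the
analogous statement for the topological group `Δ^tp_{X̲̲} = dUU l` ALONE is FALSE (`l ≥ 3`):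
* §2 `exists_closure_nielsen` — the discrete Nielsen move `Ψ₀` of file 1 extends to a bi-continuous automorphism
  `Ψ` of `W := cl η(Ker χ₀) = {x ∈ F̂₂ | ĥ_l(x).x = 0}` (profinite completion of `U`, [SemiAnbd] §6: restriction of
  `η : Δ → F̂₂` to the open finite-index `U`, extension of `ι_U ∘ Ψ₀^{±1}` by the universal property, the two
  composites are the identity by uniqueness; `W = Ker(x_l)` since both have index `l`); by density and (i) of file 1,
  `Ψ` preserves the completed degree `ê` and the `z`-coordinate of `ĥ_l`; it fixes `η(a^l)`; `w₀ := η(n₀)` has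
  `ê w₀ = 1`, `ĥ_N w₀ = 1` for all `N`, and `ĥ_{2l}(Ψ w₀) = (0,0,−l) ≠ 1`;
* §3 **`exists_continuousMulEquiv_dUU_not_map_thetaKerGeom`** — `Θ(w, n) := (Ψ w, n)` is a bi-continuous
  automorphism of `↥(dUU l)` (well defined by the two invariances), preserving the degree `pr₂`, fixing `(η a^l, l)`,
  with `γ₀ := (w₀, 0) ∈ ⋂_N Ker levelHom_N` and `levelHom_{2l}(Θ γ₀) ≠ 1`;
  **`not_isTopCharacteristic_iInf_ker_levelHom_subgroupOf_dUU`** — `¬ IsTopCharacteristic (dUU l) ((⋂_N Ker levelHom_N).subgroupOf (dUU l))`;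
  **`not_isTopCharacteristic_thetaKerχq_comap_inl_subgroupOf_dUU`** — the same with `K` written as
  `(CurveTheta.thetaKer (curveχq p i j)).comap inl`, every `p, i, j`.
CELL USE.  «(Θ) is not a property of `Δ^tp_{X̲̲}` alone»: any proof of `hΘ` at the model must use the `G_{ℚ_p}`-extension,
and NON-abelianly (`Ψ` is the identity on `U^{ab}`; cf. abc-iut-w6-d028's HTHETA-SIZING memo, which owns the plan
sentence); cousins BY NAME on the `hextΔ` side: abc-iut-L6-t13 p502505, abc-iut-w5-d125 p503499.

HONEST LABEL.  `modelχq` / `Gfp` is a SEMI-SYNTHETIC model of the typed [EtTh] §1 interface (not the tempered `π₁` of a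
curve): a statement about OUR model and the geometric shadow of OUR typed binder only; it does NOT refute `hΘ` (which
quantifies over automorphisms of `dUU l ⋊ G_{ℚ_p}`), nor anything of [EtTh] (refereed) in print, where (Θ) follows from
the arithmetic core property; nothing of [IUTchII] (claim key `Mochizuki2012`, DISPUTED, D-0012) is asserted; no side is
taken on [IUTchIII] Cor. 3.12; typed ≠ proved; nothing here says abc is proved or refuted.
bears_on: LADDER-ABC:A2.L-K (K-L6 «HTHETA-GEOM-NEG@modelTate») → LADDER-FRONTIER F-A2 (M·L6) → rung 0 `Summit.ABC`.
-/

set_option autoImplicit false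

noncomputable section

namespace Literature.AnabelianGeometry.EtaleTheta.SettingModel

open Literature.AnabelianGeometry.SemiGraphs
open Multiplicative

/-! ## §2. Transport to the closure `cl η(U) ≤ F̂₂` (profinite completion of `U`) -/

/-- **The Nielsen move on the closed subgroup `W := cl η(Ker(Δ → ℤ/l)) = {x ∈ F̂₂ | ĥ_l(x).x = 0}` of `F̂₂`.**
There is a bi-continuous automorphism `Ψ` of `W` (the profinite completion of the discrete move of §1, by the
universal property of `U → W`, [SemiAnbd] §6 p. 69) which preserves the completed degree `ê` and the `z`-coordinate
of `ĥ_l`, fixes `η(a^l)`, and sends an element `w₀ = η(n₀)` of degree `0` killed by every `ĥ_N` to an element NOT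
killed by `ĥ_{2l}`. [cite: MochizukiSemiAnbd2006, §6 p.69] -/
theorem exists_closure_nielsen (l : ℕ+) (hl : 3 ≤ (l : ℕ)) :
    ∃ (W : Subgroup F₂hatT) (Ψ : W ≃ₜ* W) (w₀ : W),
      (∀ x : F₂hatT, x ∈ W ↔ (hHat l x).x = 0) ∧
      (∀ w : W, eHat ((Ψ w : W) : F₂hatT) = eHat (w : F₂hatT)) ∧
      (∀ w : W, (hHat l ((Ψ w : W) : F₂hatT)).z = (hHat l (w : F₂hatT)).z) ∧
      (∀ w : W, (w : F₂hatT) = eta (FreeGroup.of 0 ^ (l : ℕ)) → Ψ w = w) ∧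
      eHat (w₀ : F₂hatT) = 1 ∧ (∀ N : ℕ+, hHat N (w₀ : F₂hatT) = 1) ∧
      hHat (2 * l) ((Ψ w₀ : W) : F₂hatT) ≠ 1 := by
  classical
  haveI : NeZero (l : ℕ) := ⟨l.ne_zero⟩
  haveI : Fact (1 < (l : ℕ)) := ⟨by omega⟩
  -- the character and the discrete move
  let χ₀ : F₂ →* Multiplicative (ZMod l) :=
    FreeGroup.lift fun i : Fin 2 => if i = 0 then ofAdd (1 : ZMod l) else 1
  have hχ₀ : ∀ i, χ₀ (FreeGroup.of i) = if i = 0 then ofAdd (1 : ZMod l) else 1 := fun i =>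
    FreeGroup.lift_apply_of
  let U : Subgroup Del := (χ₀.comp Del.val).ker
  obtain ⟨Ψ₀, hIA, hfix, n₀, hn₀, hΨn₀⟩ :
      ∃ Ψ₀ : U ≃* U, (∀ (M : Type) [CommGroup M] (φ : U →* M) (u : U), φ (Ψ₀ u) = φ u) ∧
        (∀ u : U, Del.val (u : Del) = FreeGroup.of 0 ^ (l : ℕ) → Ψ₀ u = u) ∧
        ∃ n₀ : U, heisHom (Del.val (n₀ : Del)) = 1 ∧ heisHom (Del.val (Ψ₀ n₀ : Del)) = ⟨0, 0, -((l : ℕ) : ℤ)⟩ :=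
    exists_nielsen_cyclicKernel l hl χ₀ hχ₀
  have hmemU : ∀ d : Del, d ∈ U ↔ (((heisHom (Del.val d)).x : ℤ) : ZMod l) = 0 := fun d => by
    change χ₀ (Del.val d) = 1 ↔ _
    rw [chi0_eq_heisHom_x l χ₀ hχ₀]
    exact ⟨fun h => by simpa using congrArg toAdd h, fun h => by rw [h]; rfl⟩
  -- the completion `ι = η : Δ → F̂₂` and its restriction to `U`
  let ι : Del →ₜ* F₂hatT := etaCont Del
  have hιapp : ∀ d : Del, ι d = eta (Del.val d) := fun _ => rfl
  have hι : IsProfiniteCompletion ι := isProfiniteCompletion_of_eta (F := Del) (etaCont Del) fun _ => rfl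
  have hUo : IsOpen (U : Set Del) := isOpen_discrete _
  have hχsurj : Function.Surjective (χ₀.comp Del.val) := by
    intro m
    refine ⟨Del.ofF₂ (FreeGroup.of 0) ^ (toAdd m).val, ?_⟩
    rw [map_pow, MonoidHom.comp_apply, Del.val_ofF₂, hχ₀, if_pos rfl, ← ofAdd_nsmul, nsmul_eq_mul,
      mul_one, ZMod.natCast_zmod_val, ofAdd_toAdd]
  haveI hUfi : U.FiniteIndex := by
    haveI : Finite (Del ⧸ (χ₀.comp Del.val).ker) :=
      Finite.of_equiv _ (QuotientGroup.quotientKerEquivOfSurjective _ hχsurj).toEquiv.symm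
    exact Subgroup.finiteIndex_of_finite_quotient
  have hUidx : U.index = l := by
    change (χ₀.comp Del.val).ker.index = l
    rw [Subgroup.index_ker, MonoidHom.range_eq_top.mpr hχsurj, Subgroup.card_top, Nat.card_eq_fintype_card,
      Fintype.card_multiplicative, ZMod.card]
  let W : Subgroup F₂hatT := (U.map ι.toMonoidHom).topologicalClosure
  obtain ⟨ιU, hιU, hcU⟩ : ∃ ιU : U →ₜ* W, (∀ u : U, ((ιU u : W) : F₂hatT) = ι u) ∧ IsProfiniteCompletion ιU :=
    hι.exists_restrict_of_isOpen_of_finiteIndex U hUo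
  haveI := hcU.compactSpace; haveI := hcU.t2Space; haveI := hcU.totallyDisconnectedSpace
  have hιU' : ∀ u : U, ((ιU u : W) : F₂hatT) = eta (Del.val (u : Del)) := fun u => by rw [hιU]; rfl
  -- `W = {x | ĥ_l(x).x = 0}` (both of index `l`, one inside the other)
  let xl : F₂hatT →ₜ* Multiplicative (ZMod l) :=
    ⟨Heis.xHom.comp (hHat l).toMonoidHom,
      (continuous_of_discreteTopology (f := (Heis.xHom : Heis (ZMod l) →* Multiplicative (ZMod l)))).comp
        (hHat l).continuous⟩
  have hxl : ∀ x, xl x = ofAdd (hHat l x).x := fun _ => rfl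
  have hWle : W ≤ xl.toMonoidHom.ker := by
    refine Subgroup.topologicalClosure_minimal _ ?_ ?_
    · rintro _ ⟨d, hd, rfl⟩
      rw [MonoidHom.mem_ker]
      change xl (ι d) = 1
      rw [hxl, hιapp, hHat_eta, Heis.map_apply]
      change ofAdd ((Int.castRingHom (ZMod l)) (heisHom (Del.val d)).x) = 1
      rw [eq_intCast, (hmemU d).mp hd]
      rfl
    · exact isClosed_singleton.preimage xl.continuous
  have hxlsurj : Function.Surjective xl.toMonoidHom := by
    intro m
    refine ⟨eta (FreeGroup.of 0 ^ (toAdd m).val), ?_⟩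
    change xl _ = m
    rw [hxl, hHat_eta, heisHom_pow_of_zero, Heis.map_apply]
    change ofAdd ((Int.castRingHom (ZMod l)) (((toAdd m).val : ℕ) : ℤ)) = m
    rw [eq_intCast, Int.cast_natCast, ZMod.natCast_zmod_val, ofAdd_toAdd]
  have hKidx : xl.toMonoidHom.ker.index = l := by
    rw [Subgroup.index_ker, MonoidHom.range_eq_top.mpr hxlsurj, Subgroup.card_top, Nat.card_eq_fintype_card,
      Fintype.card_multiplicative, ZMod.card]
  have hWidx : W.index = l := by
    change (U.map ι.toMonoidHom).topologicalClosure.index = l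
    rw [hι.index_topologicalClosure_map_eq U hUo, hUidx]
  have hWeq : W = xl.toMonoidHom.ker := by
    refine le_antisymm hWle ?_
    have h := Subgroup.relIndex_mul_index hWle
    rw [hWidx, hKidx] at h
    have h1 : W.relIndex xl.toMonoidHom.ker = 1 := by
      refine Nat.eq_of_mul_eq_mul_right l.pos ?_
      rw [h, one_mul]
    exact Subgroup.relIndex_eq_one.mp h1
  have hmemW : ∀ x : F₂hatT, x ∈ W ↔ (hHat l x).x = 0 := fun x => by
    rw [hWeq, MonoidHom.mem_ker]
    change xl x = 1 ↔ _
    rw [hxl]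
    exact ⟨fun h => by simpa using congrArg toAdd h, fun h => by rw [h]; rfl⟩
  -- the two extensions and the automorphism `Ψ` of `W`
  let Ψ₀c : U →ₜ* U := ⟨Ψ₀.toMonoidHom, continuous_of_discreteTopology⟩
  let Ψ₀c' : U →ₜ* U := ⟨Ψ₀.symm.toMonoidHom, continuous_of_discreteTopology⟩
  obtain ⟨Φ, hΦ⟩ := hcU.exists_extension (ιU.comp Ψ₀c)
  obtain ⟨Φ', hΦ'⟩ := hcU.exists_extension (ιU.comp Ψ₀c')
  have hΦu : ∀ u : U, Φ (ιU u) = ιU (Ψ₀ u) := hΦ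
  have hΦ'u : ∀ u : U, Φ' (ιU u) = ιU (Ψ₀.symm u) := hΦ'
  have h12 : Φ'.comp Φ = ContinuousMonoidHom.id W := hcU.extension_unique _ _ fun u => by
    change Φ' (Φ (ιU u)) = ιU u
    rw [hΦu, hΦ'u, MulEquiv.symm_apply_apply]
  have h21 : Φ.comp Φ' = ContinuousMonoidHom.id W := hcU.extension_unique _ _ fun u => by
    change Φ (Φ' (ιU u)) = ιU u
    rw [hΦ'u, hΦu, MulEquiv.apply_symm_apply]
  have hli : Function.LeftInverse Φ' Φ := fun x => by change (Φ'.comp Φ) x = x; rw [h12]; rfl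
  have hri : Function.RightInverse Φ' Φ := fun y => by change (Φ.comp Φ') y = y; rw [h21]; rfl
  let Ψ : W ≃ₜ* W := ContinuousMulEquiv.mk (MulEquiv.mk ⟨Φ, Φ', hli, hri⟩ (map_mul Φ)) Φ.continuous Φ'.continuous
  have hΨ : ∀ w, Ψ w = Φ w := fun _ => rfl
  -- `Ψ` preserves `ê` and the `z`-coordinate (density of `ι(U)` in `W`; `Ψ₀` is IA)
  have hdense : DenseRange ιU := hcU.denseRange
  have hexpA : ∀ u : U, expA (Del.val ((Ψ₀ u : U) : Del)) = expA (Del.val (u : Del)) := fun u =>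
    hIA (Multiplicative ℤ) (expA.comp (Del.val.comp U.subtype)) u
  have heHat : ∀ w : W, eHat ((Ψ w : W) : F₂hatT) = eHat (w : F₂hatT) := by
    have key : (fun w : W => eHat ((Ψ w : W) : F₂hatT)) = fun w : W => eHat (w : F₂hatT) := by
      refine hdense.equalizer ?_ ?_ ?_
      · exact eHat.continuous.comp (continuous_subtype_val.comp Ψ.continuous)
      · exact eHat.continuous.comp continuous_subtype_val
      · funext u
        simp only [Function.comp_apply]
        rw [hΨ, hΦu, hιU', hιU', eHat_eta, eHat_eta, hexpA]
    exact fun w => congrFun key w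
  -- the `z`-coordinate mod `l` is a homomorphism on `U` (the cross term `x₁ y₂` dies since `x₁ ≡ 0`)
  let zl : U →* Multiplicative (ZMod l) :=
    { toFun := fun u => ofAdd (((heisHom (Del.val (u : Del))).z : ZMod l))
      map_one' := by simp
      map_mul' := fun u v => by
        have hu : (((heisHom (Del.val (u : Del))).x : ℤ) : ZMod l) = 0 := (hmemU _).mp u.2
        rw [← ofAdd_add, Subgroup.coe_mul, map_mul, map_mul, Heis.mul_z, Int.cast_add, Int.cast_add, Int.cast_mul,
          hu, zero_mul, add_zero] }
  have hzl : ∀ u : U, zl u = ofAdd (((heisHom (Del.val (u : Del))).z : ZMod l)) := fun _ => rfl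
  have hzU : ∀ u : U, (((heisHom (Del.val ((Ψ₀ u : U) : Del))).z : ℤ) : ZMod l) =
      (((heisHom (Del.val (u : Del))).z : ℤ) : ZMod l) := fun u => by
    have := hIA (Multiplicative (ZMod l)) zl u
    rw [hzl, hzl] at this
    exact ofAdd.injective this
  have hz : ∀ w : W, (hHat l ((Ψ w : W) : F₂hatT)).z = (hHat l (w : F₂hatT)).z := by
    have key : (fun w : W => (hHat l ((Ψ w : W) : F₂hatT)).z) = fun w : W => (hHat l (w : F₂hatT)).z := by
      refine hdense.equalizer ?_ ?_ ?_
      · exact (continuous_of_discreteTopology (f := fun h : Heis (ZMod l) => h.z)).comp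
          ((hHat l).continuous.comp (continuous_subtype_val.comp Ψ.continuous))
      · exact (continuous_of_discreteTopology (f := fun h : Heis (ZMod l) => h.z)).comp
          ((hHat l).continuous.comp continuous_subtype_val)
      · funext u
        simp only [Function.comp_apply]
        rw [hΨ, hΦu, hιU', hιU', hHat_eta, hHat_eta, Heis.map_apply, Heis.map_apply]
        change (Int.castRingHom (ZMod l)) _ = (Int.castRingHom (ZMod l)) _
        rw [eq_intCast, eq_intCast, hzU]
    exact fun w => congrFun key w
  -- `Ψ` fixes `η(a^l)`
  have hAl : ∀ w : W, (w : F₂hatT) = eta (FreeGroup.of 0 ^ (l : ℕ)) → Ψ w = w := by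
    intro w hw
    have hmem : Del.ofF₂ (FreeGroup.of 0 ^ (l : ℕ)) ∈ U := by
      rw [hmemU, Del.val_ofF₂, heisHom_pow_of_zero]
      change (((l : ℕ) : ℤ) : ZMod l) = 0
      rw [Int.cast_natCast, ZMod.natCast_self]
    have hwu : w = ιU ⟨_, hmem⟩ := by
      apply Subtype.ext
      rw [hιU', hw]
      rfl
    rw [hwu, hΨ, hΦu, hfix ⟨_, hmem⟩ rfl]
  -- the witness
  refine ⟨W, Ψ, ιU n₀, hmemW, heHat, hz, hAl, ?_, fun N => ?_, ?_⟩
  · rw [hιU', eHat_eta, expA_apply, hn₀, Heis.one_x]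
    rfl
  · rw [hιU', hHat_eta, hn₀, map_one]
  · rw [hΨ, hΦu, hιU', hHat_eta, hΨn₀, Heis.map_apply]
    intro h
    have hz0 := congrArg Heis.z h
    simp only [Heis.one_z, map_neg, map_natCast, neg_eq_zero] at hz0
    rw [ZMod.natCast_eq_zero_iff] at hz0
    have h2 := Nat.le_of_dvd l.pos hz0
    rw [PNat.mul_coe, show ((2 : ℕ+) : ℕ) = 2 from rfl] at h2
    have h3 := l.pos; omega


/-! ## §3. The automorphism of `Δ^tp_{X̲̲} = dUU l` and the verdict -/

/-- **The (Θ)-clause of [EtTh] Cor. 2.18 (i) is NOT a property of the geometric tempered group `Δ^tp_{X̲̲}` alone.**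
At the model (`Γ = F̂₂ ×_Ẑ ℤ`, `Δ^tp_{X̲̲} = dUU l = {l ∣ deg, z ≡ 0 (l)}`, `l ≥ 3`) there is a bi-continuous automorphism
`Θ` of the topological group `dUU l` which preserves the degree `pr₂`, fixes the Frobenius-like element `(η a^l, l)`
(hence commutes with its inner automorphism), and carries an element of `Ker(Δ^tp ↠ (Δ^tp)^Θ) ∩ dUU l = ⋂_N Ker ĥ_N`
OUTSIDE that kernel (detected by `ĥ_{2l}`). [cite: MochizukiEtTh2009, Cor 2.18(i) p.60] -/
theorem exists_continuousMulEquiv_dUU_not_map_thetaKerGeom (l : ℕ+) (hl : 3 ≤ (l : ℕ)) :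
    ∃ Θ : ↥(dUU l) ≃ₜ* ↥(dUU l),
      (∀ γ : ↥(dUU l), gfpSnd ((Θ γ : ↥(dUU l)) : Gfp) = gfpSnd (γ : Gfp)) ∧
      (∀ γ : ↥(dUU l), gfpFst (γ : Gfp) = eta (FreeGroup.of 0 ^ (l : ℕ)) → Θ γ = γ) ∧
      ∃ γ₀ : ↥(dUU l), (∀ N : ℕ+, levelHom N (γ₀ : Gfp) = 1) ∧ levelHom (2 * l) ((Θ γ₀ : ↥(dUU l)) : Gfp) ≠ 1 := by
  obtain ⟨W, Ψ, w₀, hmemW, heHat, hz, hAl, hw₀e, hw₀N, hw₀⟩ := exists_closure_nielsen l hl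
  -- membership bookkeeping
  have hlev : ∀ (N : ℕ+) (γ : Gfp), levelHom N γ = hHat N ((γ : F₂hatT × Multiplicative ℤ).1) := fun _ _ => rfl
  have hW_of : ∀ γ : ↥(dUU l), ((γ : Gfp) : F₂hatT × Multiplicative ℤ).1 ∈ W := fun γ => by
    rw [hmemW, ← hlev]
    exact ((mem_dUU_iff l (γ : Gfp)).mp γ.2).1
  have heHat' : ∀ w : W, eHat ((Ψ.symm w : W) : F₂hatT) = eHat (w : F₂hatT) := fun w => by
    conv_rhs => rw [← Ψ.apply_symm_apply w, heHat (Ψ.symm w)]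
  have hz' : ∀ w : W, (hHat l ((Ψ.symm w : W) : F₂hatT)).z = (hHat l (w : F₂hatT)).z := fun w => by
    conv_rhs => rw [← Ψ.apply_symm_apply w, hz (Ψ.symm w)]
  -- the forward and backward maps
  have hmk : ∀ (E : W ≃ₜ* W), (∀ w : W, eHat ((E w : W) : F₂hatT) = eHat (w : F₂hatT)) →
      (∀ w : W, (hHat l ((E w : W) : F₂hatT)).z = (hHat l (w : F₂hatT)).z) →
      ∀ γ : ↥(dUU l), ∃ δ : ↥(dUU l), ((δ : Gfp) : F₂hatT × Multiplicative ℤ) =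
        (((E ⟨_, hW_of γ⟩ : W) : F₂hatT), ((γ : Gfp) : F₂hatT × Multiplicative ℤ).2) := by
    intro E hE hEz γ
    have hG : ((((E ⟨_, hW_of γ⟩ : W) : F₂hatT), ((γ : Gfp) : F₂hatT × Multiplicative ℤ).2) :
        F₂hatT × Multiplicative ℤ) ∈ Gfp := by
      rw [mem_Gfp, hE]
      exact (mem_Gfp _).mp (γ : Gfp).2
    refine ⟨⟨⟨_, hG⟩, ?_⟩, rfl⟩
    rw [mem_dUU_iff, hlev]
    refine ⟨(hmemW _).mp (E ⟨_, hW_of γ⟩).2, ?_⟩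
    change (hHat l ((E ⟨_, hW_of γ⟩ : W) : F₂hatT)).z = 0
    rw [hEz]
    have h2 := ((mem_dUU_iff l (γ : Gfp)).mp γ.2).2
    rw [hlev] at h2
    exact h2
  choose F hF using hmk Ψ heHat hz
  choose G hG using hmk Ψ.symm heHat' hz'
  have hF1 : ∀ γ, (((F γ : ↥(dUU l)) : Gfp) : F₂hatT × Multiplicative ℤ).1 = ((Ψ ⟨_, hW_of γ⟩ : W) : F₂hatT) :=
    fun γ => by rw [hF γ]
  have hF2 : ∀ γ, (((F γ : ↥(dUU l)) : Gfp) : F₂hatT × Multiplicative ℤ).2 = ((γ : Gfp) : F₂hatT × Multiplicative ℤ).2 :=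
    fun γ => by rw [hF γ]
  have hG1 : ∀ γ, (((G γ : ↥(dUU l)) : Gfp) : F₂hatT × Multiplicative ℤ).1 = ((Ψ.symm ⟨_, hW_of γ⟩ : W) : F₂hatT) :=
    fun γ => by rw [hG γ]
  have hG2 : ∀ γ, (((G γ : ↥(dUU l)) : Gfp) : F₂hatT × Multiplicative ℤ).2 = ((γ : Gfp) : F₂hatT × Multiplicative ℤ).2 :=
    fun γ => by rw [hG γ]
  have hext : ∀ γ δ : ↥(dUU l), ((γ : Gfp) : F₂hatT × Multiplicative ℤ) = ((δ : Gfp) : F₂hatT × Multiplicative ℤ) →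
      γ = δ := fun γ δ h => Subtype.ext (Subtype.ext h)
  have hWext : ∀ (x y : F₂hatT) (hx : x ∈ W) (hy : y ∈ W), x = y → (⟨x, hx⟩ : W) = ⟨y, hy⟩ := fun _ _ _ _ h => Subtype.ext h
  -- `F`, `G` are mutually inverse homomorphisms, continuous
  have hFG : Function.LeftInverse G F := fun γ => by
    refine hext _ _ (Prod.ext ?_ ?_)
    · have e1 : (⟨_, hW_of (F γ)⟩ : W) = Ψ ⟨_, hW_of γ⟩ := hWext _ _ _ _ (hF1 γ)
      rw [hG1, e1, Ψ.symm_apply_apply]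
    · rw [hG2, hF2]
  have hGF : Function.RightInverse G F := fun γ => by
    refine hext _ _ (Prod.ext ?_ ?_)
    · have e1 : (⟨_, hW_of (G γ)⟩ : W) = Ψ.symm ⟨_, hW_of γ⟩ := hWext _ _ _ _ (hG1 γ)
      rw [hF1, e1, Ψ.apply_symm_apply]
    · rw [hF2, hG2]
  have hFmul : ∀ γ δ, F (γ * δ) = F γ * F δ := fun γ δ => by
    refine hext _ _ (Prod.ext ?_ ?_)
    · have eR : (((F γ * F δ : ↥(dUU l)) : Gfp) : F₂hatT × Multiplicative ℤ).1 =
          ((Ψ ⟨_, hW_of γ⟩ : W) : F₂hatT) * ((Ψ ⟨_, hW_of δ⟩ : W) : F₂hatT) := by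
        simp only [Subgroup.coe_mul, Prod.fst_mul, hF1]
      rw [hF1, eR, ← Subgroup.coe_mul, ← map_mul]
      exact congrArg (fun w : W => ((Ψ w : W) : F₂hatT))
        (hWext _ _ _ _ (by simp only [Subgroup.coe_mul, Prod.fst_mul]))
    · simp only [hF2, Subgroup.coe_mul, Prod.snd_mul]
  have hval : Continuous fun γ : ↥(dUU l) => ((γ : Gfp) : F₂hatT × Multiplicative ℤ) := continuous_subtype_val.comp continuous_subtype_val
  have hcont : ∀ (E : W ≃ₜ* W) (T : ↥(dUU l) → ↥(dUU l)),
      (∀ γ, (((T γ : ↥(dUU l)) : Gfp) : F₂hatT × Multiplicative ℤ).1 = ((E ⟨_, hW_of γ⟩ : W) : F₂hatT)) →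
      (∀ γ, (((T γ : ↥(dUU l)) : Gfp) : F₂hatT × Multiplicative ℤ).2 = ((γ : Gfp) : F₂hatT × Multiplicative ℤ).2) →
      Continuous T := by
    intro E T h1 h2
    have hfun : (fun γ => ((T γ : ↥(dUU l)) : Gfp) : ↥(dUU l) → Gfp) =
        fun γ => ⟨(((E ⟨_, hW_of γ⟩ : W) : F₂hatT), ((γ : Gfp) : F₂hatT × Multiplicative ℤ).2),
          by rw [← h1, ← h2]; exact ((T γ : ↥(dUU l)) : Gfp).2⟩ := by
      funext γ
      exact Subtype.ext (Prod.ext (h1 γ) (h2 γ))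
    refine Continuous.subtype_mk ?_ _
    · rw [hfun]
      refine Continuous.subtype_mk (Continuous.prodMk ?_ ?_) _
      · exact continuous_subtype_val.comp (E.continuous.comp ((continuous_fst.comp hval).subtype_mk _))
      · exact continuous_snd.comp hval
  let Θ : ↥(dUU l) ≃ₜ* ↥(dUU l) :=
    ContinuousMulEquiv.mk (MulEquiv.mk ⟨F, G, hFG, hGF⟩ hFmul) (hcont Ψ F hF1 hF2) (hcont Ψ.symm G hG1 hG2)
  have hΘ : ∀ γ, Θ γ = F γ := fun _ => rfl
  -- the witness `γ₀ = (w₀, 0)`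
  have hγ₀G : (((w₀ : F₂hatT), (1 : Multiplicative ℤ)) : F₂hatT × Multiplicative ℤ) ∈ Gfp := by
    rw [mem_Gfp, hw₀e, map_one]
  have hγ₀ : (⟨_, hγ₀G⟩ : Gfp) ∈ dUU l := by
    rw [mem_dUU_iff, hlev]
    change (hHat l (w₀ : F₂hatT)).x = 0 ∧ (hHat l (w₀ : F₂hatT)).z = 0
    rw [hw₀N]
    exact ⟨rfl, rfl⟩
  refine ⟨Θ, fun γ => ?_, fun γ hγ => ?_, ⟨⟨_, hγ₀G⟩, hγ₀⟩, fun N => ?_, ?_⟩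
  · rw [hΘ, gfpSnd_apply, gfpSnd_apply, hF2]
  · rw [hΘ]
    refine hext _ _ (Prod.ext ?_ ?_)
    · rw [hF1, hAl _ hγ]
    · rw [hF2]
  · rw [hlev]
    exact hw₀N N
  · rw [hΘ, hlev, hF1]
    have h : (⟨_, hW_of ⟨⟨_, hγ₀G⟩, hγ₀⟩⟩ : W) = w₀ := Subtype.ext rfl
    rw [h]
    exact hw₀

/-- **Corollary (intrinsic form).** `⋂_N Ker(ĥ_N ∘ pr₁) ∩ dUU l` — the `Γ`-part of `Ker(Π^tp_{X̲̲} ↠ (Π^tp_X)^Θ)` — is NOT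
topologically characteristic in `Δ^tp_{X̲̲} = dUU l`: the `_false_without_G_{ℚ_p}` negative for the binder `hΘ` of the
K-L6 display of [IUTchII] Cor. 1.12 (any proof of `hΘ` at the model must use the arithmetic extension).
[cite: MochizukiEtTh2009, Cor 2.18(i) p.60] -/
theorem not_isTopCharacteristic_iInf_ker_levelHom_subgroupOf_dUU (l : ℕ+) (hl : 3 ≤ (l : ℕ)) :
    ¬ IsTopCharacteristic (dUU l) ((⨅ N : ℕ+, (levelHom N).ker).subgroupOf (dUU l)) := by
  intro hchar
  obtain ⟨Θ, -, -, γ₀, hγ₀, hΘγ₀⟩ := exists_continuousMulEquiv_dUU_not_map_thetaKerGeom l hl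
  have hmem : γ₀ ∈ (⨅ N : ℕ+, (levelHom N).ker).subgroupOf (dUU l) := by
    rw [Subgroup.mem_subgroupOf, Subgroup.mem_iInf]
    exact fun N => hγ₀ N
  have himg : Θ γ₀ ∈ ((⨅ N : ℕ+, (levelHom N).ker).subgroupOf (dUU l)).map Θ.toMulEquiv.toMonoidHom :=
    ⟨γ₀, hmem, rfl⟩
  rw [hchar Θ, Subgroup.mem_subgroupOf, Subgroup.mem_iInf] at himg
  exact hΘγ₀ (himg (2 * l))

/-- **Corollary (at the stage-2 Tate models).** For every `p, i, j`, the pull-back to `Γ` of the theta kernel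
`Ker(Π^tp_X ↠ (Π^tp_X)^Θ)` of `curveχq p i j` (abc-iut-L6-d6's `mem_thetaKerχq_iff`), restricted to `Δ^tp_{X̲̲} = dUU l`,
is NOT topologically characteristic in the topological group `dUU l` alone — whereas the cell's binder `hΘ` asks it of
`Π^tp_{X̲̲} = dUU l ⋊ G_{ℚ_p}`: the clause, if true, is true BECAUSE of the Galois factor.
[cite: MochizukiEtTh2009, Cor 2.18(i) p.60] -/
theorem not_isTopCharacteristic_thetaKerχq_comap_inl_subgroupOf_dUU (p : ℕ) [Fact p.Prime] (i j : ℤ)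
    (l : ℕ+) (hl : 3 ≤ (l : ℕ)) :
    ¬ IsTopCharacteristic (dUU l)
      (((CurveTheta.thetaKer (curveχq p i j)).comap
        (SemidirectProduct.inl : Gfp →* PiTpχq p i j)).subgroupOf (dUU l)) := by
  have hK : (CurveTheta.thetaKer (curveχq p i j)).comap (SemidirectProduct.inl : Gfp →* PiTpχq p i j) =
      ⨅ N : ℕ+, (levelHom N).ker := by
    ext γ
    rw [Subgroup.mem_comap, mem_thetaKerχq_iff, Subgroup.mem_iInf]
    simp only [SemidirectProduct.left_inl, SemidirectProduct.right_inl, and_true, MonoidHom.mem_ker]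
    exact Iff.rfl
  rw [hK]
  exact not_isTopCharacteristic_iInf_ker_levelHom_subgroupOf_dUU l hl

end Literature.AnabelianGeometry.EtaleTheta.SettingModel

end
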